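import Literature.Computability.Complexity.CircuitAdderMultiplier

/-!
# The bits of the B₃₀ power-sum exponents by polynomial-size `B₂`-circuits

Support file for item `MomentCurveDefinable` (route GirthSidon, `stmt-ValiantsHypothesis-6544`);
the closing theorem is `momentCurveDefinable_proof` in `…GirthSidonMomentCurveDefinable.lean`.

For the index `i < 2^K` given by its `K` bits, the exponent of the `i`-th coordinate of the
moment curve is `E(i) = ∑_{k<60} (i+1)^k · 2^{60 K k}` (`momentVal`; in the route `K = 10 q`,
`m = 2^K`, `m^{60 k} = 2^{60 K k}`). Since `(i+1)^k ≤ 2^{K k} < 2^{60 K}` for `k < 60` (and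
`K ≥ 1`), the binary expansion of `E(i)` is the concatenation of sixty `60K`-bit blocks holding
`(i+1)^0, …, (i+1)^{59}` (`testBit_sum_digits`). A straight-line `B₂`-program
(`Literature.Computability.Complexity.CktSize`) computes bit `j` of `E(i)`: increment `i` by the
ripple-carry adder (`ArithCkt.cktSize_addBits`), then iterate "multiply the register by `i+1`
and keep the low `60K` bits" (`ArithCkt.cktSize_mulBits`, `CktSize.iterate`) `⌊j / 60K⌋` times
and read bit `j mod 60K` (`cktSize_momentBit`); bundling over `j < n` gives
`cktSize_momentBits : CktSize B2 (momentBits K n) (momentSize K n)` with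
`momentSize K n = n · (powInitSize K + 59 · powStepSize K + 1)`, a polynomial in `n` and `K`.
Everything here is folklore circuit bookkeeping (Vollmer 1999, §1; Wegener 1987, Ch. 3).
-/

-- D-0017 layout `Summit.<Summit>.<Sub>.Theorems` with Sub = Summit: the duplicated component is intended.
set_option linter.dupNamespace false

namespace Summit.ValiantsHypothesis.ValiantsHypothesis.Theorems

open Literature.Computability.Complexity Literature.Computability.Complexity.ArithCkt Finset

namespace GirthSidonBitDef

/-! ### The exponents and their digit structure -/

/-- The power-sum exponent `E(i) = ∑_{k<60} (i+1)^k · 2^{60 K k}` (digit width `60 K`).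
[folklore] -/
def momentVal (K i : ℕ) : ℕ := ∑ k ∈ Finset.range 60, (i + 1) ^ k * 2 ^ (60 * K * k)

/-- Bit `j < n` of `E(i)` as a function of the `K` bits of `i`. [folklore] -/
def momentBits (K n : ℕ) (b : Fin K → Bool) (j : Fin n) : Bool :=
  (momentVal K (Nat.ofBits b)).testBit j

/-- **Digits**: for `t k < 2^W` (`k < N`, `W ≥ 1`), bit `j` of `∑_{k<N} t k · 2^{W k}` is bit
`j mod W` of the digit `t ⌊j/W⌋` (and `0` beyond the last digit). [folklore] -/
theorem testBit_sum_digits {W : ℕ} (hW : 0 < W) : ∀ (N : ℕ) (t : ℕ → ℕ),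
    (∀ k < N, t k < 2 ^ W) → ∀ j : ℕ,
      (∑ k ∈ Finset.range N, t k * 2 ^ (W * k)).testBit j =
        if j / W < N then (t (j / W)).testBit (j % W) else false
  | 0, t, _, j => by simp
  | N + 1, t, ht, j => by
    have hsplit : ∑ k ∈ Finset.range (N + 1), t k * 2 ^ (W * k) =
        2 ^ W * (∑ k ∈ Finset.range N, t (k + 1) * 2 ^ (W * k)) + t 0 := by
      rw [Finset.sum_range_succ', Finset.mul_sum]
      congr 1
      · refine Finset.sum_congr rfl fun k _ => ?_
        rw [mul_add, mul_one, pow_add]; ring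
      · simp
    rw [hsplit, Nat.testBit_two_pow_mul_add _ (ht 0 (Nat.succ_pos N))]
    by_cases hj : j < W
    · rw [if_pos hj, Nat.div_eq_of_lt hj, if_pos (Nat.succ_pos N), Nat.mod_eq_of_lt hj]
    · rw [if_neg hj, testBit_sum_digits hW N (fun k => t (k + 1))
        (fun k hk => ht (k + 1) (by omega)) (j - W)]
      have hWj : W ≤ j := not_lt.1 hj
      rw [Nat.div_eq_sub_div hW hWj, Nat.mod_eq_sub_mod hWj]
      by_cases h2 : (j - W) / W < N
      · rw [if_pos h2, if_pos (by omega)]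
      · rw [if_neg h2, if_neg (by omega)]

/-- The digits fit: `u^k < 2^{60K}` for `u ≤ 2^K`, `k < 60`, `K ≥ 1`. [folklore] -/
theorem pow_digit_lt {K : ℕ} (hK : 1 ≤ K) {u : ℕ} (hu : u ≤ 2 ^ K) {k : ℕ} (hk : k < 60) :
    u ^ k < 2 ^ (60 * K) :=
  calc u ^ k ≤ (2 ^ K) ^ k := Nat.pow_le_pow_left hu k
    _ = 2 ^ (K * k) := by rw [← pow_mul]
    _ < 2 ^ (60 * K) := by
        refine Nat.pow_lt_pow_right (by norm_num) ?_
        calc K * k ≤ K * 59 := Nat.mul_le_mul_left K (by omega)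
          _ < 60 * K := by omega

/-- Bit `j` of `E(i)` for `i < 2^K`, `K ≥ 1`: bit `j mod 60K` of `(i+1)^{⌊j/60K⌋}`, or `0`.
[folklore] -/
theorem testBit_momentVal {K : ℕ} (hK : 1 ≤ K) {i : ℕ} (hi : i < 2 ^ K) (j : ℕ) :
    (momentVal K i).testBit j =
      if j / (60 * K) < 60 then ((i + 1) ^ (j / (60 * K))).testBit (j % (60 * K)) else false := by
  unfold momentVal
  exact testBit_sum_digits (by omega) 60 (fun k => (i + 1) ^ k)
    (fun k hk => pow_digit_lt hK hi hk) j

/-! ### The powering stage: `u = i + 1` and a register, multiplied in rounds -/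

/-- Wires of the powering stage: the `60K` bits of `u = i + 1` and a `60K`-bit register.
[folklore] -/
abbrev PW (K : ℕ) : Type := Fin (60 * K) ⊕ Fin (60 * K)

/-- One round: keep `u`, replace the register `R` by the low `60K` bits of `u · R`
(schoolbook multiplier). [folklore] -/
def powStep (K : ℕ) (y : PW K → Bool) : PW K → Bool :=
  Sum.elim (fun l => y (Sum.inl l)) fun l => mulBits (60 * K) y (Fin.castAdd (60 * K) l)

/-- Gate budget of one round. [folklore] -/
def powStepSize (K : ℕ) : ℕ := 0 + ((60 * K) * mulStepSize (60 * K) + 1)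

/-- One round by a `B₂`-program of size `powStepSize K`. [folklore] -/
theorem cktSize_powStep (K : ℕ) : CktSize B2 (powStep K) (powStepSize K) :=
  ((CktSize.proj B2 (fun l : Fin (60 * K) => (Sum.inl l : PW K))).pair
    ((cktSize_mulBits (60 * K)).outMap (Fin.castAdd (60 * K)))).congr fun y w => by
    rcases w with l | l <;> rfl

/-- **The powering invariant**: after `k` rounds from register `1`, the register holds the low
`60K` bits of `u^k`. [folklore] -/
theorem iterate_powStep (K : ℕ) (ub : Fin (60 * K) → Bool) : ∀ k : ℕ,
    (powStep K)^[k] (Sum.elim ub fun l => Nat.testBit 1 l) =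
      Sum.elim ub fun l : Fin (60 * K) => (Nat.ofBits ub ^ k % 2 ^ (60 * K)).testBit l
  | 0 => by
    funext w
    rcases w with l | l
    · rfl
    · simp only [Function.iterate_zero, id_eq, Sum.elim_inr, pow_zero, Nat.testBit_mod_two_pow,
        l.isLt, decide_true, Bool.true_and]
  | k + 1 => by
    rw [Function.iterate_succ_apply', iterate_powStep K ub k]
    funext w
    rcases w with l | l
    · rfl
    · have h1 : ∀ x : ℕ, (x % 2 ^ (60 * K)).testBit l = x.testBit l := fun x => by
        rw [Nat.testBit_mod_two_pow]; simp [l.isLt]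
      have key : Nat.ofBits ub * (Nat.ofBits ub ^ k % 2 ^ (60 * K)) % 2 ^ (60 * K) =
          Nat.ofBits ub ^ (k + 1) % 2 ^ (60 * K) := by
        rw [Nat.mul_mod, Nat.mod_mod, ← Nat.mul_mod, pow_succ']
      simp only [powStep, Sum.elim_inl, Sum.elim_inr, mulBits, bitsOf, mulVal, Nat.ofBits_testBit,
        Nat.mod_mod, Fin.val_castAdd]
      rw [← h1 (Nat.ofBits (fun i => ub i) * _), key]

/-- The initial wires: `u = i + 1` padded to `60K` bits, and the register `1`. [folklore] -/
def powInit (K : ℕ) (b : Fin K → Bool) : PW K → Bool :=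
  Sum.elim (fun l => (Nat.ofBits b + 1).testBit l) fun l => Nat.testBit 1 l

/-- Gate budget of the initial stage. [folklore] -/
def powInitSize (K : ℕ) : ℕ := K + addSize K + 2

/-- Routing the initial wires to the adder outputs and two constants. [folklore] -/
def initRoute (K : ℕ) : PW K → Fin (K + 1) ⊕ (Unit ⊕ Unit) :=
  Sum.elim (fun l => if h : l.val < K + 1 then Sum.inl ⟨l.val, h⟩ else Sum.inr (Sum.inl ()))
    fun l => if l.val = 0 then Sum.inr (Sum.inr ()) else Sum.inr (Sum.inl ())

/-- The bits of the constant `1` on `K ≥ 1` wires spell `1`. [folklore] -/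
theorem ofBits_testBit_one {K : ℕ} (hK : 1 ≤ K) :
    Nat.ofBits (fun t : Fin K => Nat.testBit 1 t) = 1 := by
  rw [Nat.ofBits_testBit, Nat.mod_eq_of_lt (Nat.one_lt_two_pow (by omega))]

/-- **The initial stage** (`K ≥ 1`): increment by the ripple-carry adder, pad, constants.
[folklore] -/
theorem cktSize_powInit {K : ℕ} (hK : 1 ≤ K) : CktSize B2 (powInit K) (powInitSize K) := by
  -- stage 1: the input bits and the bits of the constant `1`
  have h1 : CktSize B2 (fun b : Fin K → Bool => Sum.elim b fun t : Fin K => Nat.testBit 1 t)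
      (0 + Fintype.card (Fin K) * 1) :=
    (CktSize.id B2).pair (CktSize.pi_const fun t => cktSize_const (Fin K) (Nat.testBit 1 t))
  -- stage 2: the adder
  have h2 := h1.comp (cktSize_addBits K)
  -- stage 3: two constants and the routing
  have h3 : CktSize B2 (fun z : Fin (K + 1) → Bool =>
      Sum.elim z (Sum.elim (fun _ : Unit => false) fun _ : Unit => true)) (0 + (1 + 1)) :=
    (CktSize.id B2).pair ((cktSize_const (Fin (K + 1)) false).pair (cktSize_const (Fin (K + 1)) true))
  have h4 := ((h2.comp h3).outMap (initRoute K)).of_le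
    (show 0 + Fintype.card (Fin K) * 1 + addSize K + (0 + (1 + 1)) ≤ powInitSize K by
      simp [powInitSize])
  refine h4.congr fun b w => ?_
  have hval : addVal K (Sum.elim b fun t : Fin K => Nat.testBit 1 t) = Nat.ofBits b + 1 := by
    simp only [addVal, Sum.elim_inl, Sum.elim_inr]
    rw [ofBits_testBit_one hK]
  rcases w with l | l
  · -- the padded increment
    simp only [initRoute, Sum.elim_inl, powInit]
    by_cases hl : l.val < K + 1
    · rw [dif_pos hl]
      simp only [Sum.elim_inl, addBits, bitsOf, hval]
    · rw [dif_neg hl]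
      simp only [Sum.elim_inr, Sum.elim_inl]
      symm
      refine Nat.testBit_lt_two_pow ?_
      have hb := Nat.ofBits_lt_two_pow b
      calc Nat.ofBits b + 1 ≤ 2 ^ K := hb
        _ < 2 ^ l.val := Nat.pow_lt_pow_right (by norm_num) (by omega)
  · -- the register `1`
    simp only [initRoute, Sum.elim_inr, powInit]
    by_cases hl : l.val = 0
    · rw [if_pos hl]
      simp [hl]
    · rw [if_neg hl]
      simp only [Sum.elim_inr, Sum.elim_inl]
      exact (Nat.testBit_lt_two_pow (Nat.one_lt_two_pow hl)).symm

/-! ### One output bit, and the bundle -/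

/-- Gate budget for one output bit. [folklore] -/
def momentBitSize (K : ℕ) : ℕ := powInitSize K + 59 * powStepSize K + 1

/-- **Bit `j` of `E(i)` by a `B₂`-program** (`K ≥ 1`): initial stage, `⌊j/60K⌋ < 60` rounds,
read bit `j mod 60K` of the register; a constant `0` beyond the last block. [folklore] -/
theorem cktSize_momentBit {K : ℕ} (n : ℕ) (hK : 1 ≤ K) (j : Fin n) :
    CktSize B2 (fun b (_ : Unit) => momentBits K n b j) (momentBitSize K) := by
  have hW : 0 < 60 * K := by omega
  by_cases hj : j.val / (60 * K) < 60
  · have h := ((cktSize_powInit hK).comp ((cktSize_powStep K).iterate (j.val / (60 * K)))).outMap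
      fun _ : Unit => (Sum.inr ⟨j.val % (60 * K), Nat.mod_lt _ hW⟩ : PW K)
    refine (h.of_le ?_).congr fun b _ => ?_
    · have : j.val / (60 * K) * powStepSize K ≤ 59 * powStepSize K :=
        Nat.mul_le_mul_right _ (by omega)
      unfold momentBitSize; omega
    · have hu : Nat.ofBits b + 1 ≤ 2 ^ K := Nat.ofBits_lt_two_pow b
      have hub : Nat.ofBits (fun l : Fin (60 * K) => (Nat.ofBits b + 1).testBit l) = Nat.ofBits b + 1 := by
        rw [Nat.ofBits_testBit]
        refine Nat.mod_eq_of_lt ?_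
        have h1 := pow_digit_lt hK hu (show 1 < 60 by norm_num)
        rwa [pow_one] at h1
      rw [powInit, iterate_powStep, Sum.elim_inr, hub, momentBits,
        testBit_momentVal hK (Nat.ofBits_lt_two_pow b), if_pos hj, Nat.testBit_mod_two_pow]
      simp [Nat.mod_lt _ hW]
  · refine ((cktSize_const (Fin K) false).of_le (by unfold momentBitSize; omega)).congr fun b _ => ?_
    rw [momentBits, testBit_momentVal hK (Nat.ofBits_lt_two_pow b), if_neg hj]

/-- Gate budget of the whole bit map. [folklore] -/
def momentSize (K n : ℕ) : ℕ := n * momentBitSize K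

/-- **The bits of the moment exponents by a polynomial-size `B₂`-program**, for every `K`
(for `K = 0` the map is constant). [folklore] -/
theorem cktSize_momentBits (K n : ℕ) : CktSize B2 (momentBits K n) (momentSize K n) := by
  rcases Nat.eq_zero_or_pos K with rfl | hK
  · have h : CktSize B2 (fun (_ : Fin 0 → Bool) (j : Fin n) => momentBits 0 n Fin.elim0 j)
        (Fintype.card (Fin n) * 1) :=
      CktSize.pi_const fun j => cktSize_const (Fin 0) (momentBits 0 n Fin.elim0 j)
    refine (h.of_le ?_).congr fun b j => ?_
    · simp only [Fintype.card_fin, momentSize, momentBitSize]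
      exact Nat.mul_le_mul_left n (by omega)
    · rw [Subsingleton.elim b Fin.elim0]
  · have h : CktSize B2 (fun b (j : Fin n) => momentBits K n b j) (Fintype.card (Fin n) * momentBitSize K) :=
      CktSize.pi_const fun j => cktSize_momentBit n hK j
    simpa [momentSize] using h

end GirthSidonBitDef

end Summit.ValiantsHypothesis.ValiantsHypothesis.Theorems
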